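import Literature.NumberTheory.GelbartRogawski1991.LocalDoubledDeltaFunctionalEquivariance
import HarnessLib

/-!
# The `Δ`-functional of the doubled Schrödinger model is a NON-DEGENERATE pairing of the two blocks

Topic `NumberTheory/GelbartRogawski1991`; namespace `Literature.NumberTheory.GelbartRogawski1991.UnitaryDualPair.LocalSplitting`.  KERNEL ONLY:
theorems; no definition, no named fact, no `sorry`, no instance, no notation.  Cell `hodgecm-mathlib` (D-0151), fan B, L1ns road (P) of the crux
hLiu418 — brick B2b of the «doubling relation (D)» (memo `F0/P6/B-p04/g44/MEMO-L1ns-road.v3.B-p04g44.md`); `--supports stmt-HodgeConjecture-24832`,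
count-neutral.  Sequel of ★ `LocalDoubledDeltaFunctionalEquivariance` (same setting: `ρ^𝔻 = localSchrodinger F (n+n) (gramD F n T₀) v`, blocks
`ρ_{T₀}`, `ρ_{−T₀}`, `m₀` carrying `ℓ_Δ` onto `ℓ_Y`, `λ(Φ) := (ω(m₀) Φ)(0)`).

* `exists_linearMap_apply_zero_toRep` — `λ` as a linear functional; `exists_apply_zero_toRep_boxSB_ne_zero` — `λ ≠ 0` on some product
  (★ `apply_zero_toRep_ne_zero` + ★ `exists_apply_boxSB_ne_zero`);
* **`eq_zero_of_forall_apply_zero_toRep_boxSB_left_eq_zero`** ∕ **`…_right_eq_zero`** — `λ(f₁ ⊠ f₂) = 0` for all `f₂` forces `f₁ = 0` (and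
  symmetrically): the annihilator `⋂_{f₂} ker λ(· ⊠ f₂)` is `ρ_{T₀}`-stable by the transfer ★ `apply_zero_toRep_boxSB_schrodinger_left`, hence `⊥` or
  `⊤` by the irreducibility ★ `eq_bot_or_eq_top_of_invariant_schrodingerSB_gram`, and not `⊤` by the first clause.

Consumer (brick B3): with ★ `apply_zero_toRep_boxSB_restrict_diagD` (the diagonal eigen-law of Kudla's CM splitting) this gives the DUALITY OF BLOCK
TYPES «types(restrictRight s^𝔻) = (χ_v∘det)·types(restrictLeft s^𝔻)⁻¹», hence `χ₀² = μ_v²` for the vanishing character of [Liu2021, Lem. D.1 (1)] at an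
anisotropic plane.  HC_CM is NOT proved here and is proved only modulo the printed citations (2 remaining named inputs hLiu418, h413) until rung 0 closes.

## References
* [MoeglinVignerasWaldspurger1987] C. Mœglin, M.-F. Vignéras, J.-L. Waldspurger, LNM 1291 (1987), Chap. 2 I.3 (irreducibility of `𝒮`), II.1 (B),
  Rem. (6) (the doubled space and product vectors).
* [Kudla1994] S. Kudla, *Splitting metaplectic covers of dual reductive pairs*, Israel J. Math. 87 (1994), §2 (doubled space, Siegel parabolic, `Δ`).
* [WeilBNT1967] A. Weil, *Basic Number Theory* (1967), Chap. VII §2 Prop. 2 (products span `𝒮` of a product).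
-/

set_option autoImplicit false

noncomputable section

open scoped Matrix TensorProduct
open NumberField IsDedekindDomain MeasureTheory Matrix
open Literature.RepresentationTheory.HeisenbergGroup
open Literature.NumberTheory.Automorphic Literature.NumberTheory.Automorphic.UnitaryGroup

namespace Literature.NumberTheory.GelbartRogawski1991.UnitaryDualPair.LocalSplitting

/-! ## §3 NON-DEGENERACY of the pairing `(f₁, f₂) ↦ (ω(m₀)(f₁ ⊠ f₂))(0)` -/

section Nondegenerate

variable (F : Type) [Field F] [NumberField F] (v : HeightOneSpectrum (𝓞 F)) (n : ℕ) {T₀ : Matrix (Fin n) (Fin n) F}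
  (hT₀d : IsUnit T₀.det) (m₀ : LocalMp F (n + n) (gramD F n T₀) v)
  (hm₀ : (deltaLagrangian F v n).map (toLin F v (MpPsi.proj _ m₀)) = lagrangianY F (n + n) v)


/-- `Φ ↦ (ω(m₀) Φ)(0)` as a linear functional (evaluation at `0` after the implementer `ω(m₀)`).
[cite: MoeglinVignerasWaldspurger1987, Chap. 2 II.1 (B)] -/
theorem exists_linearMap_apply_zero_toRep :
    ∃ lam : SchwartzBruhat (Fin (n + n) → (v.adicCompletion F)) →ₗ[ℂ] ℂ, ∀ Φ, lam Φ =
      ((MpPsi.toRep (localSchrodinger F (n + n) (gramD F n T₀) v) m₀ Φ : SchwartzBruhat (Fin (n + n) → (v.adicCompletion F))) : (Fin (n + n) → (v.adicCompletion F)) → ℂ) 0 :=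
  ⟨(LinearMap.proj (0 : Fin (n + n) → (v.adicCompletion F))) ∘ₗ (SchwartzBruhat (Fin (n + n) → (v.adicCompletion F))).subtype ∘ₗ
      (MpPsi.toRep (localSchrodinger F (n + n) (gramD F n T₀) v) m₀), fun _ => rfl⟩

/-- `Φ ↦ (ω(m₀) Φ)(0)` does not vanish on all product vectors. [cite: MoeglinVignerasWaldspurger1987, Chap. 2 II.1 (B)]
[cite: WeilBNT1967, Chap. VII §2, Prop. 2] -/
theorem exists_apply_zero_toRep_boxSB_ne_zero :
    ∃ (f₁ f₂ : SchwartzBruhat (Fin n → (v.adicCompletion F))),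
      ((MpPsi.toRep (localSchrodinger F (n + n) (gramD F n T₀) v) m₀ (boxSB (v.adicCompletion F) (e₂ n) f₁ f₂) : SchwartzBruhat (Fin (n + n) → (v.adicCompletion F))) :
        (Fin (n + n) → (v.adicCompletion F)) → ℂ) 0 ≠ 0 := by
  obtain ⟨lam, hlam⟩ := exists_linearMap_apply_zero_toRep F v n m₀
  have hne : lam ≠ 0 := by
    obtain ⟨Φ, hΦ⟩ := apply_zero_toRep_ne_zero F (n + n) (gramD F n T₀) v m₀
    intro h0
    apply hΦ
    rw [← hlam, h0, LinearMap.zero_apply]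
  obtain ⟨f₁, f₂, h⟩ := exists_apply_boxSB_ne_zero (v.adicCompletion F) (e₂ n) lam hne
  exact ⟨f₁, f₂, by rwa [← hlam]⟩

include hT₀d hm₀ in
/-- **NON-DEGENERACY IN THE FIRST SLOT**: if `(ω(m₀)(f₁ ⊠ f₂))(0) = 0` for all `f₂` then `f₁ = 0`.  The annihilator
`⋂_{f₂} ker (f₁ ↦ (ω(m₀)(f₁ ⊠ f₂))(0))` is a subspace of `𝒮(F_v^n)` stable under `ρ_{T₀}` (transfer across the `Δ`-functional), hence
`⊥` or `⊤` by the irreducibility of the Schrödinger model; it is not `⊤` because the functional does not vanish on all products.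
[cite: MoeglinVignerasWaldspurger1987, Chap. 2 I.3, II.1 Rem. (6)] [cite: Kudla1994, §2 (doubled space, Siegel parabolic)] -/
theorem eq_zero_of_forall_apply_zero_toRep_boxSB_left_eq_zero (f₁ : SchwartzBruhat (Fin n → (v.adicCompletion F)))
    (h : ∀ f₂ : SchwartzBruhat (Fin n → (v.adicCompletion F)),
      ((MpPsi.toRep (localSchrodinger F (n + n) (gramD F n T₀) v) m₀ (boxSB (v.adicCompletion F) (e₂ n) f₁ f₂) : SchwartzBruhat (Fin (n + n) → (v.adicCompletion F))) :
        (Fin (n + n) → (v.adicCompletion F)) → ℂ) 0 = 0) :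
    f₁ = 0 := by
  obtain ⟨lam, hlam⟩ := exists_linearMap_apply_zero_toRep F v n m₀
  -- the slice functionals `f₁ ↦ λ(f₁ ⊠ f₂)` and the annihilator subspace
  let ℓ : SchwartzBruhat (Fin n → (v.adicCompletion F)) → (SchwartzBruhat (Fin n → (v.adicCompletion F)) →ₗ[ℂ] ℂ) := fun f₂ =>
    lam ∘ₗ (sumEquivSB (v.adicCompletion F) (e₂ n)).toLinearMap ∘ₗ (TensorProduct.mk ℂ (SchwartzBruhat (Fin n → (v.adicCompletion F))) (SchwartzBruhat (Fin n → (v.adicCompletion F)))).flip f₂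
  have hℓ : ∀ g f₂, ℓ f₂ g =
      ((MpPsi.toRep (localSchrodinger F (n + n) (gramD F n T₀) v) m₀ (boxSB (v.adicCompletion F) (e₂ n) g f₂) : SchwartzBruhat (Fin (n + n) → (v.adicCompletion F))) :
        (Fin (n + n) → (v.adicCompletion F)) → ℂ) 0 := by
    intro g f₂
    change lam (sumEquivSB (v.adicCompletion F) (e₂ n) (g ⊗ₜ f₂)) = _
    rw [sumEquivSB_tmul, hlam]
  let W : Submodule ℂ (SchwartzBruhat (Fin n → (v.adicCompletion F))) := ⨅ f₂, LinearMap.ker (ℓ f₂)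
  have hmem : ∀ g, g ∈ W ↔ ∀ f₂,
      ((MpPsi.toRep (localSchrodinger F (n + n) (gramD F n T₀) v) m₀ (boxSB (v.adicCompletion F) (e₂ n) g f₂) : SchwartzBruhat (Fin (n + n) → (v.adicCompletion F))) :
        (Fin (n + n) → (v.adicCompletion F)) → ℂ) 0 = 0 := by
    intro g
    simp only [W, Submodule.mem_iInf, LinearMap.mem_ker, hℓ]
  -- `W` is stable under the Schrödinger model of the first block (transfer across the `Δ`-functional)
  have hW : ∀ (a : Heisenberg (polar (localPairing F n T₀ v))) (g : SchwartzBruhat (Fin n → (v.adicCompletion F))), g ∈ W →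
      localSchrodinger F n T₀ v a g ∈ W := by
    intro a g hg
    rw [hmem] at hg ⊢
    intro f₂
    rw [apply_zero_toRep_boxSB_schrodinger_left F v n T₀ m₀ hm₀ a g f₂, hg, mul_zero]
  rcases eq_bot_or_eq_top_of_invariant_schrodingerSB_gram (localGram F n T₀ v) (BlockSum.isUnit_det_localGram F v hT₀d)
      (isLocallyConstant_of_isContinuousNontrivial (isContinuousNontrivial_adeleAddCharAt F v))
      (continuous_toLinearMap₂'_left (localGram F n T₀ v)) (isContinuousNontrivial_adeleAddCharAt F v) W hW with hbot | htop
  · have hf : f₁ ∈ W := (hmem f₁).2 h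
    rw [hbot] at hf
    exact (Submodule.mem_bot ℂ).1 hf
  · exfalso
    obtain ⟨g₁, g₂, hne⟩ := exists_apply_zero_toRep_boxSB_ne_zero F v n m₀
    have hg₁ : g₁ ∈ W := by rw [htop]; exact Submodule.mem_top
    exact hne ((hmem g₁).1 hg₁ g₂)

include hT₀d hm₀ in
/-- **NON-DEGENERACY IN THE SECOND SLOT**: if `(ω(m₀)(f₁ ⊠ f₂))(0) = 0` for all `f₁` then `f₂ = 0` (same proof on the second block,
irreducibility of `ρ_{−T₀}`). [cite: MoeglinVignerasWaldspurger1987, Chap. 2 I.3, II.1 Rem. (6)] [cite: Kudla1994, §2 (doubled space, Siegel parabolic)] -/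
theorem eq_zero_of_forall_apply_zero_toRep_boxSB_right_eq_zero (f₂ : SchwartzBruhat (Fin n → (v.adicCompletion F)))
    (h : ∀ f₁ : SchwartzBruhat (Fin n → (v.adicCompletion F)),
      ((MpPsi.toRep (localSchrodinger F (n + n) (gramD F n T₀) v) m₀ (boxSB (v.adicCompletion F) (e₂ n) f₁ f₂) : SchwartzBruhat (Fin (n + n) → (v.adicCompletion F))) :
        (Fin (n + n) → (v.adicCompletion F)) → ℂ) 0 = 0) :
    f₂ = 0 := by
  obtain ⟨lam, hlam⟩ := exists_linearMap_apply_zero_toRep F v n m₀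
  let ℓ : SchwartzBruhat (Fin n → (v.adicCompletion F)) → (SchwartzBruhat (Fin n → (v.adicCompletion F)) →ₗ[ℂ] ℂ) := fun f₁ =>
    lam ∘ₗ (sumEquivSB (v.adicCompletion F) (e₂ n)).toLinearMap ∘ₗ TensorProduct.mk ℂ (SchwartzBruhat (Fin n → (v.adicCompletion F))) (SchwartzBruhat (Fin n → (v.adicCompletion F))) f₁
  have hℓ : ∀ g f₁, ℓ f₁ g =
      ((MpPsi.toRep (localSchrodinger F (n + n) (gramD F n T₀) v) m₀ (boxSB (v.adicCompletion F) (e₂ n) f₁ g) : SchwartzBruhat (Fin (n + n) → (v.adicCompletion F))) :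
        (Fin (n + n) → (v.adicCompletion F)) → ℂ) 0 := by
    intro g f₁
    change lam (sumEquivSB (v.adicCompletion F) (e₂ n) (f₁ ⊗ₜ g)) = _
    rw [sumEquivSB_tmul, hlam]
  let W : Submodule ℂ (SchwartzBruhat (Fin n → (v.adicCompletion F))) := ⨅ f₁, LinearMap.ker (ℓ f₁)
  have hmem : ∀ g, g ∈ W ↔ ∀ f₁,
      ((MpPsi.toRep (localSchrodinger F (n + n) (gramD F n T₀) v) m₀ (boxSB (v.adicCompletion F) (e₂ n) f₁ g) : SchwartzBruhat (Fin (n + n) → (v.adicCompletion F))) :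
        (Fin (n + n) → (v.adicCompletion F)) → ℂ) 0 = 0 := by
    intro g
    simp only [W, Submodule.mem_iInf, LinearMap.mem_ker, hℓ]
  have hW : ∀ (b : Heisenberg (polar (localPairing F n (-T₀) v))) (g : SchwartzBruhat (Fin n → (v.adicCompletion F))), g ∈ W →
      localSchrodinger F n (-T₀) v b g ∈ W := by
    intro b g hg
    rw [hmem] at hg ⊢
    intro f₁
    rw [apply_zero_toRep_boxSB_schrodinger_right F v n T₀ m₀ hm₀ b f₁ g, hg, mul_zero]
  have hnegd : IsUnit (-T₀).det := by
    rw [Matrix.det_neg]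
    exact ((isUnit_one.neg).pow _).mul hT₀d
  rcases eq_bot_or_eq_top_of_invariant_schrodingerSB_gram (localGram F n (-T₀) v) (BlockSum.isUnit_det_localGram F v hnegd)
      (isLocallyConstant_of_isContinuousNontrivial (isContinuousNontrivial_adeleAddCharAt F v))
      (continuous_toLinearMap₂'_left (localGram F n (-T₀) v)) (isContinuousNontrivial_adeleAddCharAt F v) W hW with hbot | htop
  · have hf : f₂ ∈ W := (hmem f₂).2 h
    rw [hbot] at hf
    exact (Submodule.mem_bot ℂ).1 hf
  · exfalso
    obtain ⟨g₁, g₂, hne⟩ := exists_apply_zero_toRep_boxSB_ne_zero F v n m₀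
    have hg₂ : g₂ ∈ W := by rw [htop]; exact Submodule.mem_top
    exact hne ((hmem g₂).1 hg₂ g₁)

end Nondegenerate


end Literature.NumberTheory.GelbartRogawski1991.UnitaryDualPair.LocalSplitting

end
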